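import Literature.MathematicalPhysics.QuantumFieldTheory.Balaban1983to89.Node00.Record13
import Literature.MathematicalPhysics.QuantumFieldTheory.Balaban1983to89.Node00.SmallFieldChi29AxOfRecord

/-!
# NODE 00 — [Ax-3] of WORK ORDER RC-1 «RE-CENTRE THE RECORD» (director-ym №462 (B)∕№463; CRIT-1 g33 RULING Q-3 (iii)): the Stage-13 β-slot χ and
# the β-functions of record RE-CENTRED at print's block-axial critical configuration — `chiβOfRecord₁₃Ax`, `betaOfRecord₁₃Ax` — one-token twins of
# `Node00/Record13` :163∕:180 reading `[Ax-2]`'s `chiFixed29Ax` (append-only NEW names; no body of record touched, body-freeze №460 (2))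

CITATION HEADER.  [I] = [Balaban1987RG1] (CMP **109**; held `paper:balaban1987-cmp109-rg-i-small-field`), (2.9) p. 266 the fluctuation cut-off
`χ_k = Π χ({|B′(b)| < ε₁})`, `V = exp(iB′)V^{(k)}` with `V^{(k)}` «the element of the orbit satisfying the axial gauge conditions G(V) = 0» (p. 265 L21–23,
(2.3)); (1.20)–(1.22) p. 264 the β-functions; (0.19) p. 255.

WHY (cell `ym-nodeO-ideate` ∕ `ym-balaban-port`; located reading «CHOICE CHANNEL», porter PT-A-2, UPHELD CRIT-1 g33 Q-3, adopted director-ym №462): the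
Stage-13 record feeds the β-layer the (2.9) species `chiβOfRecord₁₃ θ := chiFixed29 F N θ.ν θ.ε₂₉` CENTRED AT `Ū^k(Classical.choose …)`; every value read
through it (`recordΦf`, `betaOfRecord₁₃`) depends on the choice.  `[Ax-2]` (`Node00/SmallFieldChi29AxOfRecord`, this seat) re-centres the cut-off at the
block-axial representative (`critCfgAxOfRecord`, choice-free on the [B11] domain, `G = 0`, block-lift covariant); THIS FILE is the two Stage-13 abbrevs over it,
EXACT twins of :163∕:180 with `chiFixed29 ↦ chiFixed29Ax` — the names `[Ax-4]` (DEF-1 ed. 9 `recordΦfAx`) and the re-cut port texts (27930⁸'s flow guard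
`FlowStep.RGEqH k (betaOfRecord₁₃Ax …) g`, 26648 v3) read.  `gOfRecord₁₃Ax`∕`EOfRecord₁₃Ax`∕`Provisos…Ax` belong to the K-record restate (director (D)) and
are NOT filed here.
HONEST FRAMING.  Two abbrevs + `rfl` unfoldings; nothing of Bałaban's asserted, ported or discharged; K0⁷∕K1⁹∕K3⁸ AS VETTED still read the choice-centred
cut-off (restate pending the director); no `sorry`∕`instance`∕`notation`; standard axioms; the YM mass gap (Clay) is NOT proved by any of this.
-/

noncomputable section

namespace Literature.MathematicalPhysics.QuantumFieldTheory.Balaban1983to89.Node00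

open T4Continuum (T4Family)
open FlowStep (HBeta)

variable (F : T4Family) (N : ℕ) [NeZero N]

/-- **THE β-SLOT SMALL-FIELD FUNCTION OF RECORD, Stage 13, RE-CENTRED = THE (2.9) SPECIES AT THE BLOCK-AXIAL CRITICAL CONFIGURATION** `χ^{(2.9)}_{k,ax}` at
threshold `θ.ε₂₉` (`[Ax-2]`'s `chiFixed29Ax θ.ν θ.ε₂₉`): the twin of `chiβOfRecord₁₃` (:163) with the cut-off centred where print centres it.
[cite: Balaban1987RG1, (2.9) p.266, p.265 (2.3), (0.19) p.255] -/
abbrev chiβOfRecord₁₃Ax (θ : Stage13Params F N) : (K : ℕ) → (ℕ → ℝ) → (k : ℕ) → Density (F.P K) k (SU N) :=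
  chiFixed29Ax F N θ.ν θ.ε₂₉

/-- **THE β-FUNCTIONS OF RECORD, Stage 13, RE-CENTRED**: [I] (1.20)–(1.22) on the merged term (1.6) with every input `A_{k+1}` read through the β-layer
transport of record `TβOfRecord₁₃` and the RE-CENTRED (2.9) species `chiβOfRecord₁₃Ax θ` — the twin of `betaOfRecord₁₃` (:180).
[cite: Balaban1987RG1, (1.20)–(1.22) p.264, (2.9) p.266] -/
abbrev betaOfRecord₁₃Ax (θ : Stage13Params F N) : HBeta :=
  betaOfRecord₈Tχ F N (TβOfRecord₁₃ F N) (chiβOfRecord₁₃Ax F N θ) θ.toStage8Params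

variable {F N}

/-- Unfolding (`rfl`): the re-centred β is def-B's χ-generic β at `χ := chiFixed29Ax θ.ν θ.ε₂₉`. [cite: Balaban1987RG1, (1.20)–(1.22) p.264 (bookkeeping)] -/
theorem betaOfRecord₁₃Ax_eq_betaOfRecord₈Tχ (θ : Stage13Params F N) :
    betaOfRecord₁₃Ax F N θ = betaOfRecord₈Tχ F N (TβOfRecord₁₃ F N) (chiFixed29Ax F N θ.ν θ.ε₂₉) θ.toStage8Params := rfl

/-- The re-centred β-slot χ is coupling-blind (`rfl`). [cite: Balaban1987RG1, (2.9) p.266 (bookkeeping)] -/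
theorem chiβOfRecord₁₃Ax_flowBlind (θ : Stage13Params F N) (K : ℕ) (g g' : ℕ → ℝ) : chiβOfRecord₁₃Ax F N θ K g = chiβOfRecord₁₃Ax F N θ K g' := rfl

/-- Unfolding at a step (`rfl`): the re-centred β-slot χ at `(K, g, k)` is `[Ax-2]`'s `chiFix29AxOfRecord θ.ν θ.ε₂₉ K k`. [cite: Balaban1987RG1, (2.9) p.266 (bookkeeping)] -/
theorem chiβOfRecord₁₃Ax_apply (θ : Stage13Params F N) (K : ℕ) (g : ℕ → ℝ) (k : ℕ) :
    chiβOfRecord₁₃Ax F N θ K g k = chiFix29AxOfRecord F N θ.ν θ.ε₂₉ K k := rfl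

end Literature.MathematicalPhysics.QuantumFieldTheory.Balaban1983to89.Node00

end
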